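import Mathlib
import HarnessLib
import Summits.ValiantsHypothesis.ValiantsHypothesis.Theorems.LacunarySymmetroidMatrixDescartesProductPlusOneSlopeKnee
import Summits.ValiantsHypothesis.ValiantsHypothesis.Theorems.LacunarySymmetroidMatrixDescartesProductPlusOneSlopeLine

/-!
# LINE (A) `product_plus_one`, floor in W-currency: the KNEE cell in the line's currency — one one-signed binomial knee against an incoherent
# cloud carries ≤ 2 zeros of `W(∏ f)` per window (≤ 3 of `eulerNumerator d a l₀`, every coupling)

Line-currency wrapper of ✓ `…SlopeKnee` (`oneKnee_slope_no_three_zeros`) through ✓ `logWronskian_prod_eq_rowPsi1_sum` (asked by the pen val-idea-25 g4,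
2026-08-29 03:08Z, for the rev-27 wire).  K = 3, `d 1 = d 0 + e₁ + 1`, `d 2 = d 1 + e₂ + 1`; knee row `j₀` = a ONE-SIGNED TOP BINOMIAL
(`a_{j₀1} = 0`, `a_{j₀0}·a_{j₀2} > 0`: the E(n) knee `1 + (x/S)^q` up to scaling); every other row an incoherent puller (`a_{j0} > 0`, `a_{j1} ≤ 0`, `a_{j2} ≤ 0`,
`a_{j1} + a_{j2} < 0`) unswitched at the right end of the window `⊂ (0,∞)`:
* ★★ `oneKnee_trinomialCloud_wronskian_no_three_zeros` — `W(∏_j Σ_l C a_{jl} X^{d_l})` does not vanish at three points of the window;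
* ★ `oneKnee_trinomialCloud_wronskian_roots_le_two` — `#{zeros of W(P) in (u,v)} ≤ 2`;
* ★★ `oneKnee_trinomialCloud_eulerNumerator_roots_le_three` — `#{zeros of eulerNumerator d a l₀ in [u,v]} ≤ 3` for EVERY coupling `l₀`.
So an ISOLATED knee against an incoherent pull costs at most two zeros of the company's log-Wronskian (the owner's E(n) family: exactly two per knee
against one binomial puller; several knees at once = the multi-hump budget, OPEN — the abstract count Q-LC is false, bus 03:03Z).

HONEST FRAMING: one cell; `OneChangeFloorK3` / `WronskianBudgetK3` / the stubs / `MatrixDescartes` OPEN; `VP ≠ VNP` NOT proved.  No definitions, no named facts.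
-/

set_option linter.dupNamespace false

namespace Summit.ValiantsHypothesis.ValiantsHypothesis.Theorems.LacunarySymmetroidMatrixDescartes

namespace ProductPlusOne

open Finset Polynomial
open scoped BigOperators Polynomial

/-- ★★ **ONE ONE-SIGNED BINOMIAL KNEE AGAINST ANY INCOHERENT CLOUD: the company's log-Wronskian has NO THREE ZEROS on the window** (LINE currency).
[this file's theorem] -/
theorem oneKnee_trinomialCloud_wronskian_no_three_zeros {m : ℕ} (d : Fin 3 → ℕ) (e₁ e₂ : ℕ)
    (he₁ : d 1 = d 0 + e₁ + 1) (he₂ : d 2 = d 1 + e₂ + 1)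
    (a : Fin m → Fin 3 → ℝ) (j₀ : Fin m) (hk1 : a j₀ 1 = 0) (hk02 : 0 < a j₀ 0 * a j₀ 2)
    (hpul : ∀ j, j ≠ j₀ → 0 < a j 0 ∧ a j 1 ≤ 0 ∧ a j 2 ≤ 0 ∧ a j 1 + a j 2 < 0)
    {x₁ x₂ x₃ : ℝ} (h0 : 0 < x₁) (h12' : x₁ < x₂) (h23 : x₂ < x₃)
    (hun : ∀ j, j ≠ j₀ → 0 < (∑ l, C (a j l) * X ^ (d l) : ℝ[X]).eval x₃)
    (hzero : ∀ x ∈ ({x₁, x₂, x₃} : Set ℝ),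
      ((∏ j, ∑ l, C (a j l) * X ^ (d l) : ℝ[X]) * (X * derivative (X * derivative (∏ j, ∑ l, C (a j l) * X ^ (d l) : ℝ[X])))
        - (X * derivative (∏ j, ∑ l, C (a j l) * X ^ (d l) : ℝ[X])) ^ 2).eval x = 0) : False := by
  classical
  have hd := fin3_support_eq_gaps d e₁ e₂ he₁ he₂
  have hev : ∀ j x, (∑ l, C (a j l) * X ^ (d l) : ℝ[X]).eval x
        = x ^ (d 0) * (a j 0 - (-(a j 1)) * x ^ (e₁ + 1) - (-(a j 2)) * x ^ (e₁ + e₂ + 2)) := by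
    intro j x
    have h := (eval_trinomial_three (d 0) (e₁ + 1) (e₁ + e₂ + 2) (a j) x).1
    rw [hd] at h; rw [h]; ring
  have h13 : x₁ < x₃ := h12'.trans h23
  have hIcc : ∀ x ∈ ({x₁, x₂, x₃} : Set ℝ), x ∈ Set.Icc x₁ x₃ := by
    intro x hx
    simp only [Set.mem_insert_iff, Set.mem_singleton_iff] at hx
    rcases hx with h | h | h <;> (subst h; constructor <;> linarith)
  have hx3 : 0 < x₃ := h0.trans h13
  have hAC : a j₀ 0 * (-(a j₀ 2)) < 0 := by linarith
  -- the knee never vanishes; the pullers are unswitched on the whole window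
  have hknee : ∀ x, 0 < x → a j₀ 0 - (-(a j₀ 1)) * x ^ (e₁ + 1) - (-(a j₀ 2)) * x ^ (e₁ + e₂ + 2) ≠ 0 := by
    intro x hx h
    rw [hk1, neg_zero, zero_mul, sub_zero] at h
    have : a j₀ 0 = -(a j₀ 2) * x ^ (e₁ + e₂ + 2) := by linarith
    have h2 : a j₀ 0 * a j₀ 2 = -(a j₀ 2 ^ 2 * x ^ (e₁ + e₂ + 2)) := by rw [this]; ring
    have : 0 ≤ a j₀ 2 ^ 2 * x ^ (e₁ + e₂ + 2) := by positivity
    linarith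
  have hp' : ∀ x ∈ Set.Icc x₁ x₃, ∀ j, j ≠ j₀ → 0 < a j 0 - (-(a j 1)) * x ^ (e₁ + 1) - (-(a j 2)) * x ^ (e₁ + e₂ + 2) := by
    intro x hx j hj
    have hx0 : 0 < x := h0.trans_le hx.1
    obtain ⟨_, h1, h2, _⟩ := hpul j hj
    have h := hun j hj
    rw [hev] at h
    have h3 : 0 < a j 0 - (-(a j 1)) * x₃ ^ (e₁ + 1) - (-(a j 2)) * x₃ ^ (e₁ + e₂ + 2) :=
      (mul_pos_iff_of_pos_left (pow_pos hx3 _)).1 h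
    have hm1 : a j 1 * x₃ ^ (e₁ + 1) ≤ a j 1 * x ^ (e₁ + 1) :=
      mul_le_mul_of_nonpos_left (pow_le_pow_left₀ hx0.le hx.2 _) h1
    have hm2 : a j 2 * x₃ ^ (e₁ + e₂ + 2) ≤ a j 2 * x ^ (e₁ + e₂ + 2) :=
      mul_le_mul_of_nonpos_left (pow_le_pow_left₀ hx0.le hx.2 _) h2
    linarith
  have hf : ∀ x ∈ Set.Icc x₁ x₃, ∀ j, (∑ l, C (a j l) * X ^ (d l) : ℝ[X]).eval x ≠ 0 := by
    intro x hx j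
    have hx0 : 0 < x := h0.trans_le hx.1
    rw [hev]
    refine mul_ne_zero (pow_ne_zero _ hx0.ne') ?_
    by_cases hj : j = j₀
    · subst hj; exact hknee x hx0
    · exact (hp' x hx j hj).ne'
  -- the sum of the slope forms vanishes at the three points
  have hzero' : ∀ x ∈ ({x₁, x₂, x₃} : Set ℝ),
      rowPsi1 e₁ e₂ (a j₀ 0) 0 (-(a j₀ 2)) x
        + cloudP1 e₁ e₂ (Finset.univ.erase j₀) (fun _ => (1 : ℝ)) (fun j => a j 0) (fun j => -(a j 1)) (fun j => -(a j 2)) x = 0 := by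
    intro x hx
    have hxI := hIcc x hx
    have hx0 : 0 < x := h0.trans_le hxI.1
    have h := hzero x hx
    rw [logWronskian_prod_eq_rowPsi1_sum d e₁ e₂ he₁ he₂ a hx0 (hf x hxI)] at h
    have hP : ((∏ j, (∑ l, C (a j l) * X ^ (d l) : ℝ[X])).eval x) ≠ 0 := by
      rw [eval_prod]; exact Finset.prod_ne_zero_iff.2 fun j _ => hf x hxI j
    have hS : ∑ j, rowPsi1 e₁ e₂ (a j 0) (-(a j 1)) (-(a j 2)) x = 0 := by
      rcases mul_eq_zero.1 h with h1 | h1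
      · exact absurd (neg_eq_zero.1 h1) (pow_ne_zero 2 hP)
      · exact h1
    rw [← Finset.add_sum_erase _ _ (Finset.mem_univ j₀), hk1, neg_zero] at hS
    unfold cloudP1
    simpa only [one_mul] using hS
  rcases (Finset.univ.erase j₀).eq_empty_or_nonempty with hs | hs
  · have h1 := hzero' x₁ (by simp)
    rw [hs] at h1
    simp only [cloudP1, Finset.sum_empty, add_zero] at h1
    exact absurd h1 (knee_rowPsi1_neg e₁ e₂ (a j₀ 0) (-(a j₀ 2)) h0 hAC).ne
  · exact oneKnee_slope_no_three_zeros e₁ e₂ (a := a j₀ 0) (c := -(a j₀ 2)) hAC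
      (Finset.univ.erase j₀) hs (fun _ => (1 : ℝ)) (fun j => a j 0) (fun j => -(a j 1)) (fun j => -(a j 2))
      (fun _ _ => one_pos) (fun j hj => by have := (hpul j (Finset.ne_of_mem_erase hj)).2.1; linarith)
      (fun j hj => by have := (hpul j (Finset.ne_of_mem_erase hj)).2.2.1; linarith)
      (fun j hj => by have := (hpul j (Finset.ne_of_mem_erase hj)).2.2.2; linarith)
      h0 h12' h23 (fun x hx j hj => hp' x hx j (Finset.ne_of_mem_erase hj)) hzero'

/-- ★ **The knee cell carries at most TWO zeros of the company's log-Wronskian** (window `(u,v)`, pullers unswitched at `v`). [this file's theorem] -/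
theorem oneKnee_trinomialCloud_wronskian_roots_le_two {m : ℕ} (d : Fin 3 → ℕ) (e₁ e₂ : ℕ)
    (he₁ : d 1 = d 0 + e₁ + 1) (he₂ : d 2 = d 1 + e₂ + 1)
    (a : Fin m → Fin 3 → ℝ) (j₀ : Fin m) (hk1 : a j₀ 1 = 0) (hk02 : 0 < a j₀ 0 * a j₀ 2)
    (hpul : ∀ j, j ≠ j₀ → 0 < a j 0 ∧ a j 1 ≤ 0 ∧ a j 2 ≤ 0 ∧ a j 1 + a j 2 < 0)
    {u v : ℝ} (hu : 0 < u)
    (hun : ∀ j, j ≠ j₀ → 0 < (∑ l, C (a j l) * X ^ (d l) : ℝ[X]).eval v) :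
    (((∏ j, ∑ l, C (a j l) * X ^ (d l) : ℝ[X]) * (X * derivative (X * derivative (∏ j, ∑ l, C (a j l) * X ^ (d l) : ℝ[X])))
        - (X * derivative (∏ j, ∑ l, C (a j l) * X ^ (d l) : ℝ[X])) ^ 2).roots.toFinset.filter (fun w => u < w ∧ w < v)).card ≤ 2 := by
  classical
  set W : ℝ[X] := (∏ j, ∑ l, C (a j l) * X ^ (d l) : ℝ[X]) * (X * derivative (X * derivative (∏ j, ∑ l, C (a j l) * X ^ (d l) : ℝ[X])))
      - (X * derivative (∏ j, ∑ l, C (a j l) * X ^ (d l) : ℝ[X])) ^ 2 with hWdef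
  by_contra hgt
  push Not at hgt
  obtain ⟨y₁, hy₁, y₂, hy₂, y₃, hy₃, h12', h23⟩ := exists_three_lt_of_card (T := W.roots.toFinset.filter (fun w => u < w ∧ w < v)) hgt
  by_cases hW0 : W = 0
  · rw [hW0, roots_zero, Multiset.toFinset_zero, Finset.filter_empty] at hy₁; exact absurd hy₁ (Finset.notMem_empty _)
  rw [mem_filter, Multiset.mem_toFinset, mem_roots hW0] at hy₁ hy₂ hy₃
  have hd := fin3_support_eq_gaps d e₁ e₂ he₁ he₂
  have hev : ∀ j x, (∑ l, C (a j l) * X ^ (d l) : ℝ[X]).eval x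
        = x ^ (d 0) * (a j 0 + a j 1 * x ^ (e₁ + 1) + a j 2 * x ^ (e₁ + e₂ + 2)) := by
    intro j x
    have h := (eval_trinomial_three (d 0) (e₁ + 1) (e₁ + e₂ + 2) (a j) x).1
    rw [hd] at h; rw [h]; ring
  have hun3 : ∀ j, j ≠ j₀ → 0 < (∑ l, C (a j l) * X ^ (d l) : ℝ[X]).eval y₃ := by
    intro j hj
    obtain ⟨_, h1, h2, _⟩ := hpul j hj
    have h := hun j hj
    rw [hev] at h ⊢
    have hv0 : 0 < v := hu.trans (hy₃.2.1.trans hy₃.2.2)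
    have hy0 : 0 < y₃ := hu.trans hy₃.2.1
    have h3 : 0 < a j 0 + a j 1 * v ^ (e₁ + 1) + a j 2 * v ^ (e₁ + e₂ + 2) := (mul_pos_iff_of_pos_left (pow_pos hv0 _)).1 h
    have hm1 : a j 1 * v ^ (e₁ + 1) ≤ a j 1 * y₃ ^ (e₁ + 1) :=
      mul_le_mul_of_nonpos_left (pow_le_pow_left₀ hy0.le hy₃.2.2.le _) h1
    have hm2 : a j 2 * v ^ (e₁ + e₂ + 2) ≤ a j 2 * y₃ ^ (e₁ + e₂ + 2) :=
      mul_le_mul_of_nonpos_left (pow_le_pow_left₀ hy0.le hy₃.2.2.le _) h2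
    exact mul_pos (pow_pos hy0 _) (by linarith)
  refine oneKnee_trinomialCloud_wronskian_no_three_zeros d e₁ e₂ he₁ he₂ a j₀ hk1 hk02 hpul (hu.trans hy₁.2.1) h12' h23 hun3 ?_
  intro x hx
  simp only [Set.mem_insert_iff, Set.mem_singleton_iff] at hx
  rcases hx with h | h | h <;> subst h
  · exact hy₁.1
  · exact hy₂.1
  · exact hy₃.1

/-- ★★ **Hence AT MOST THREE zeros of `eulerNumerator d a l₀` on the window, for EVERY coupling `l₀`.** [this file's theorem] -/
theorem oneKnee_trinomialCloud_eulerNumerator_roots_le_three {m : ℕ} (d : Fin 3 → ℕ) (e₁ e₂ : ℕ)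
    (he₁ : d 1 = d 0 + e₁ + 1) (he₂ : d 2 = d 1 + e₂ + 1)
    (a : Fin m → Fin 3 → ℝ) (j₀ : Fin m) (hk1 : a j₀ 1 = 0) (hk02 : 0 < a j₀ 0 * a j₀ 2)
    (hpul : ∀ j, j ≠ j₀ → 0 < a j 0 ∧ a j 1 ≤ 0 ∧ a j 2 ≤ 0 ∧ a j 1 + a j 2 < 0)
    (l₀ : Fin 3) {u v : ℝ} (hu : 0 < u) (huv : u ≤ v)
    (hun : ∀ j, j ≠ j₀ → 0 < (∑ l, C (a j l) * X ^ (d l) : ℝ[X]).eval v) :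
    ((∑ j, (∑ l, C (a j l * ((d l : ℝ) - d l₀)) * X ^ (d l)) * ∏ i ∈ Finset.univ.erase j, (∑ l, C (a i l) * X ^ (d l))
        : ℝ[X]).roots.toFinset.filter (fun t => u ≤ t ∧ t ≤ v)).card ≤ 3 := by
  classical
  have hd := fin3_support_eq_gaps d e₁ e₂ he₁ he₂
  have hev : ∀ j x, (∑ l, C (a j l) * X ^ (d l) : ℝ[X]).eval x
        = x ^ (d 0) * (a j 0 + a j 1 * x ^ (e₁ + 1) + a j 2 * x ^ (e₁ + e₂ + 2)) := by
    intro j x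
    have h := (eval_trinomial_three (d 0) (e₁ + 1) (e₁ + e₂ + 2) (a j) x).1
    rw [hd] at h; rw [h]; ring
  have hv0 : 0 < v := hu.trans_le huv
  have hP : ∀ t ∈ Set.Icc u v, (∏ j, (∑ l, C (a j l) * X ^ (d l) : ℝ[X])).eval t ≠ 0 := by
    intro t ht
    have ht0 : 0 < t := hu.trans_le ht.1
    rw [eval_prod]
    refine Finset.prod_ne_zero_iff.2 fun j _ => ?_
    rw [hev]
    refine mul_ne_zero (pow_ne_zero _ ht0.ne') ?_
    by_cases hj : j = j₀
    · subst hj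
      rw [hk1, zero_mul, add_zero]
      intro h
      have e : a j 0 = -(a j 2 * t ^ (e₁ + e₂ + 2)) := by linarith
      have h2 : a j 0 * a j 2 = -(a j 2 ^ 2 * t ^ (e₁ + e₂ + 2)) := by rw [e]; ring
      have : 0 ≤ a j 2 ^ 2 * t ^ (e₁ + e₂ + 2) := by positivity
      linarith
    · obtain ⟨_, h1, h2, _⟩ := hpul j hj
      have h := hun j hj
      rw [hev] at h
      have h3 : 0 < a j 0 + a j 1 * v ^ (e₁ + 1) + a j 2 * v ^ (e₁ + e₂ + 2) := (mul_pos_iff_of_pos_left (pow_pos hv0 _)).1 h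
      have hm1 : a j 1 * v ^ (e₁ + 1) ≤ a j 1 * t ^ (e₁ + 1) :=
        mul_le_mul_of_nonpos_left (pow_le_pow_left₀ ht0.le ht.2 _) h1
      have hm2 : a j 2 * v ^ (e₁ + e₂ + 2) ≤ a j 2 * t ^ (e₁ + e₂ + 2) :=
        mul_le_mul_of_nonpos_left (pow_le_pow_left₀ ht0.le ht.2 _) h2
      exact (ne_of_gt (by linarith))
  have h1 := eulerNumerator_roots_Icc_le_wronskian_roots_add_one d a l₀ hu hP
  have h2 := oneKnee_trinomialCloud_wronskian_roots_le_two d e₁ e₂ he₁ he₂ a j₀ hk1 hk02 hpul hu hun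
  omega

end ProductPlusOne

end Summit.ValiantsHypothesis.ValiantsHypothesis.Theorems.LacunarySymmetroidMatrixDescartes
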